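import Summits.NavierStokesRegularity.TurbBounds.ShearModeAssembly
import Summits.NavierStokesRegularity.TurbBounds.ShearPSDForm
import Summits.NavierStokesRegularity.TurbBounds.Certs.S1000.EvalBlock8
import Summits.NavierStokesRegularity.TurbBounds.Certs.S1000.SpecPieces8c1
import Summits.NavierStokesRegularity.TurbBounds.Certs.S1000.SpecPieces8c2
import Summits.NavierStokesRegularity.TurbBounds.Certs.S1000.SpecPieces8c3
import Summits.NavierStokesRegularity.TurbBounds.Certs.S1000.SpecPieces8c4
import Summits.NavierStokesRegularity.TurbBounds.Certs.S1000.SpecPieces8c5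
import Summits.NavierStokesRegularity.TurbBounds.Certs.S1000.SpecPieces8c6
import Summits.NavierStokesRegularity.TurbBounds.Certs.S1000.TailSlack
import HarnessLib

/-!
# Row S1000, mode 8: the certified block as an inequality on coefficient sequences (end-to-end composition, kernel)

Cell `turb-bounds` (pub-turb), shear lane, pub-turb-shear gen 6 (2026-08-22); v2 lane. Container `C1p-fw16-Gx2-Gr1000-P20-N16-j110919` (rbcert.json sha256
15211248adbb023f…), family fw16_shear_2d, mode `m = 8`: `N = 24`, `P = 20`, `dim = 2(N+P+3) = 94`. COMPOSITION of the whole algebraic chain for this mode: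
* `Certs.S1000.Eval.M8.rule_posSemidef` (landed evaluator) + `ShearPSDForm.pieces_form_nonneg` ⇒ piece form `≥ 0` at `ω = omegaOf (N+P+4) c₁ c₂`;
* `Certs.S1000.SpecPieces.M8.*_spec` (generator C: the literal pieces ARE `q0Piece / qtPiece / qphiPiece` of rbsdp SPEC §2) ⇒ `pieces_nonneg`;
* `Certs.S1000.kappaSlack_rule_nonneg` (landed `TailSlack`) + `ShearTailSeq.T2_coeff_nonneg_of_kappaSlack` ⇒ `slack` (the `T2` coefficient `A_m − κ̃_m T ≥ 0`);
* `ShearModeAssembly.mode_assembly` ⇒ `mode_ineq`, and with `slack` ⇒ `modeForm_nonneg`: for the two ladders `c_i → a_i → b_i` (the Legendre coefficients of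
  `W_i'', W_i', W_i` of the mode's two components, wall relations `c_i(0) = c_i(1)/3`) and any cross-term remainder `X_t` within the Young bound,
  `(c₁ᵀQ1c₁ + c₂ᵀQ1c₂) + A·T2 + 8·T1 + C·T0 − D·(Σ_p φ̂_p (c₁ᵀE_p c₂ − c₂ᵀE_p c₁) + X_t) ≥ 0`.
NOT in this file: the dictionary to `A‖W''‖² + 8‖W'‖² + C‖W‖² − D∫φ'(W₂'W₁ − W₁'W₂)` (`ShearBridgeNorms.norms_split` + the cross-term split, v2 items V2-TAIL/V2-BRIDGE)
and the SPEC 2.1 reduction. Generator lean-t12/specpieces/gen_modeform_fw.py. HONEST FRAMING: rigorous bounds for the stated PDE and boundary conditions; no claim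
about physical turbulence beyond the bound.
-/

set_option linter.style.longLine false

namespace Summit.NavierStokesRegularity.TurbBounds.Certs.S1000.ModeForm.M8

open Finset Summit.NavierStokesRegularity.TurbBounds.LadderTail Summit.NavierStokesRegularity.TurbBounds.ShearTailSeq
  Summit.NavierStokesRegularity.TurbBounds.ShearSpecPieces Summit.NavierStokesRegularity.TurbBounds.Certs.S1000

/-- The profile coefficients `φ̂_p` of the row (cast). -/
def phi (p : ℕ) : ℝ := ((Scalars.phi[p]! : ℚ) : ℝ)

/-- **Piece positivity at `ω = omegaOf (N+P+4) c₁ c₂`** (landed evaluator `EvalBlock8` + generator-C identities `SpecPieces8`). -/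
theorem pieces_nonneg (c₁ c₂ : ℕ → ℝ) :
    0 ≤ qform (q0Piece 24 20 (Am Scalars.Gx SpecPieces.M8.piHi 8) (Cm Scalars.Gx Scalars.piLo 8)) (2 * (24 + 20 + 4 - 1)) (omegaOf (24 + 20 + 4) c₁ c₂)
        + ∑ p ∈ range (20 + 1), phi p * qform (qphiPiece 24 20 (Dm Scalars.Gx Scalars.piLo 8) p) (2 * (24 + 20 + 4 - 1)) (omegaOf (24 + 20 + 4) c₁ c₂)
        + (Scalars.T : ℝ) * qform (qtPiece 24 20 (Dm Scalars.Gx Scalars.piLo 8)) (2 * (24 + 20 + 4 - 1)) (omegaOf (24 + 20 + 4) c₁ c₂) := by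
  have h0 := pieces_form_nonneg Eval.M8.rule_posSemidef (fun i : Fin 94 => omegaOf (24 + 20 + 4) c₁ c₂ (i : ℕ))
  have hext : ∀ M : List (List ℚ), qform M 94 (extFin (fun i : Fin 94 => omegaOf (24 + 20 + 4) c₁ c₂ (i : ℕ))) = qform M 94 (omegaOf (24 + 20 + 4) c₁ c₂) :=
    fun M => qform_congr M 94 fun i hi => by simp [extFin, hi]
  simp only [Eval.M8.pieces1, List.map_cons, List.map_nil, List.sum_cons, List.sum_nil, hext, Rat.cast_one, one_mul] at h0
  have hQ0 := SpecPieces.M8.Q0_8_spec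
  have hQT := SpecPieces.M8.QT_8_spec
  have hQphi0 := SpecPieces.M8.Qphi0_8_spec
  have hQphi1 := SpecPieces.M8.Qphi1_8_spec
  have hQphi2 := SpecPieces.M8.Qphi2_8_spec
  have hQphi3 := SpecPieces.M8.Qphi3_8_spec
  have hQphi4 := SpecPieces.M8.Qphi4_8_spec
  have hQphi5 := SpecPieces.M8.Qphi5_8_spec
  have hQphi6 := SpecPieces.M8.Qphi6_8_spec
  have hQphi7 := SpecPieces.M8.Qphi7_8_spec
  have hQphi8 := SpecPieces.M8.Qphi8_8_spec
  have hQphi9 := SpecPieces.M8.Qphi9_8_spec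
  have hQphi10 := SpecPieces.M8.Qphi10_8_spec
  have hQphi11 := SpecPieces.M8.Qphi11_8_spec
  have hQphi12 := SpecPieces.M8.Qphi12_8_spec
  have hQphi13 := SpecPieces.M8.Qphi13_8_spec
  have hQphi14 := SpecPieces.M8.Qphi14_8_spec
  have hQphi15 := SpecPieces.M8.Qphi15_8_spec
  have hQphi16 := SpecPieces.M8.Qphi16_8_spec
  have hQphi17 := SpecPieces.M8.Qphi17_8_spec
  have hQphi18 := SpecPieces.M8.Qphi18_8_spec
  have hQphi19 := SpecPieces.M8.Qphi19_8_spec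
  have hQphi20 := SpecPieces.M8.Qphi20_8_spec
  unfold SpecPieces.M8.N SpecPieces.M8.P at hQ0 hQT hQphi0 hQphi1 hQphi2 hQphi3 hQphi4 hQphi5 hQphi6 hQphi7 hQphi8 hQphi9 hQphi10 hQphi11 hQphi12 hQphi13 hQphi14 hQphi15 hQphi16 hQphi17 hQphi18 hQphi19 hQphi20
  rw [hQ0, hQT, hQphi0, hQphi1, hQphi2, hQphi3, hQphi4, hQphi5, hQphi6, hQphi7, hQphi8, hQphi9, hQphi10, hQphi11, hQphi12, hQphi13, hQphi14, hQphi15, hQphi16, hQphi17, hQphi18, hQphi19, hQphi20] at h0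
  rw [show (2 * (24 + 20 + 4 - 1)) = 94 by norm_num]
  convert h0 using 1
  simp only [Finset.sum_range_succ, Finset.sum_range_zero, phi]
  ring

/-- **The `T2` coefficient is nonnegative** (`A_8 − κ̃_8·T ≥ 0`, from the landed `TailSlack` via `T2_coeff_nonneg_of_kappaSlack`). -/
theorem slack : 0 ≤ (((Am Scalars.Gx SpecPieces.M8.piHi 8) : ℝ) - ((Dm Scalars.Gx Scalars.piLo 8) : ℝ) * ((delta 24 : ℝ) / 2 * lam0 24 20 + lam1 24 20 / (2 * (delta 24 : ℝ))) * (Scalars.T : ℝ)) := by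
  have hmem : ShearTailRule.kappaSlack Scalars.Gx (5419351 / 1725033) Scalars.piLo Scalars.T (Scalars.Nm.getD 7 0) 20 (7 + 1)
      ∈ ShearTailRule.kappaSlackList Scalars.Gx (5419351 / 1725033) Scalars.piLo Scalars.T 20 Scalars.Nm := by
    unfold ShearTailRule.kappaSlackList
    exact List.mem_map.mpr ⟨7, List.mem_range.mpr (by simp [Scalars.Nm]), rfl⟩
  have h := kappaSlack_rule_nonneg _ hmem
  have eN : Scalars.Nm.getD 7 0 = 24 := by simp [Scalars.Nm]
  rw [eN] at h
  have h2 := T2_coeff_nonneg_of_kappaSlack h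
  have eA : (Am Scalars.Gx SpecPieces.M8.piHi 8) = ShearTailRule.Am Scalars.Gx (5419351 / 1725033) (7 + 1) := by
    unfold Am ShearTailRule.Am SpecPieces.M8.piHi; norm_num
  have eD : (Dm Scalars.Gx Scalars.piLo 8) = ShearTailRule.Dm Scalars.Gx Scalars.piLo (7 + 1) := by
    unfold Dm ShearTailRule.Dm; norm_num
  have eδ : delta 24 = ShearTailRule.delta 24 := rfl
  rw [eA, eD, eδ]
  exact h2

/-- **Mode 8 of S1000: the assembled inequality** (`mode_assembly` fed with `pieces_nonneg`). -/
theorem mode_ineq {c₁ a₁ b₁ c₂ a₂ b₂ : ℕ → ℝ}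
    (hA₁ : IsLadder c₁ a₁) (h0a₁ : a₁ 0 = c₁ 0 - c₁ 1 / 3) (hB₁ : IsLadder a₁ b₁) (hw₁ : c₁ 0 = c₁ 1 / 3)
    (hA₂ : IsLadder c₂ a₂) (h0a₂ : a₂ 0 = c₂ 0 - c₂ 1 / 3) (hB₂ : IsLadder a₂ b₂) (hw₂ : c₂ 0 = c₂ 1 / 3)
    (L : ℕ) {Xt : ℝ}
    (hX : |Xt| ≤ (Scalars.T : ℝ) * ((delta 24 : ℝ) / 2 * (∑ k ∈ range L, w (24 + 1 + k) * b₁ (24 + 1 + k) ^ 2 + ∑ k ∈ range L, w (24 + 1 + k) * b₂ (24 + 1 + k) ^ 2)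
          + (∑ k ∈ range L, w (24 + 2 + k) * a₁ (24 + 2 + k) ^ 2 + ∑ k ∈ range L, w (24 + 2 + k) * a₂ (24 + 2 + k) ^ 2) / (2 * (delta 24 : ℝ)))) :
    (((Am Scalars.Gx SpecPieces.M8.piHi 8) : ℝ) - ((Dm Scalars.Gx Scalars.piLo 8) : ℝ) * ((delta 24 : ℝ) / 2 * lam0 24 20 + lam1 24 20 / (2 * (delta 24 : ℝ))) * (Scalars.T : ℝ))
        * (∑ k ∈ range L, w (24 + 20 + 4 + k) * c₁ (24 + 20 + 4 + k) ^ 2 + ∑ k ∈ range L, w (24 + 20 + 4 + k) * c₂ (24 + 20 + 4 + k) ^ 2)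
      ≤ (qform (q1Tab 24 20 (Am Scalars.Gx SpecPieces.M8.piHi 8) (Cm Scalars.Gx Scalars.piLo 8)) (24 + 20 + 4) c₁ + qform (q1Tab 24 20 (Am Scalars.Gx SpecPieces.M8.piHi 8) (Cm Scalars.Gx Scalars.piLo 8)) (24 + 20 + 4) c₂)
        + (((Am Scalars.Gx SpecPieces.M8.piHi 8) : ℝ) * (∑ k ∈ range L, w (24 + 20 + 4 + k) * c₁ (24 + 20 + 4 + k) ^ 2 + ∑ k ∈ range L, w (24 + 20 + 4 + k) * c₂ (24 + 20 + 4 + k) ^ 2)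
           + 8 * (∑ k ∈ range L, w (24 + 2 + k) * a₁ (24 + 2 + k) ^ 2 + ∑ k ∈ range L, w (24 + 2 + k) * a₂ (24 + 2 + k) ^ 2)
           + ((Cm Scalars.Gx Scalars.piLo 8) : ℝ) * (∑ k ∈ range L, w (24 + 1 + k) * b₁ (24 + 1 + k) ^ 2 + ∑ k ∈ range L, w (24 + 1 + k) * b₂ (24 + 1 + k) ^ 2))
        - ((Dm Scalars.Gx Scalars.piLo 8) : ℝ) * ((∑ p ∈ range (20 + 1), phi p * (bform (eTab 24 20 p) (24 + 20 + 4) c₁ c₂ - bform (eTab 24 20 p) (24 + 20 + 4) c₂ c₁)) + Xt) := by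
  have hC : 0 ≤ (((Cm Scalars.Gx Scalars.piLo 8) : ℚ) : ℝ) := by unfold Cm; positivity
  have hD : 0 ≤ (((Dm Scalars.Gx Scalars.piLo 8) : ℚ) : ℝ) := by
    have : 0 < (Dm Scalars.Gx Scalars.piLo 8) := by unfold Dm; norm_num [Scalars.Gx, Scalars.piLo]
    exact_mod_cast this.le
  have hT : 0 ≤ (Scalars.T : ℝ) := by norm_num [Scalars.T]
  exact mode_assembly 24 20 (Am Scalars.Gx SpecPieces.M8.piHi 8) (Cm Scalars.Gx Scalars.piLo 8) (Dm Scalars.Gx Scalars.piLo 8) (Scalars.T : ℝ) phi hA₁ h0a₁ hB₁ hw₁ hA₂ h0a₂ hB₂ hw₂ L hC hD hT hX (pieces_nonneg c₁ c₂)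

/-- **Mode 8 of S1000 as an inequality on coefficient sequences**: tracked forms + all Parseval tails − D·(coupling + remainder) `≥ 0`
(everything kernel-checked: evaluator, generator-C identities, κ-slack, tail lemma, assembly). -/
theorem modeForm_nonneg {c₁ a₁ b₁ c₂ a₂ b₂ : ℕ → ℝ}
    (hA₁ : IsLadder c₁ a₁) (h0a₁ : a₁ 0 = c₁ 0 - c₁ 1 / 3) (hB₁ : IsLadder a₁ b₁) (hw₁ : c₁ 0 = c₁ 1 / 3)
    (hA₂ : IsLadder c₂ a₂) (h0a₂ : a₂ 0 = c₂ 0 - c₂ 1 / 3) (hB₂ : IsLadder a₂ b₂) (hw₂ : c₂ 0 = c₂ 1 / 3)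
    (L : ℕ) {Xt : ℝ}
    (hX : |Xt| ≤ (Scalars.T : ℝ) * ((delta 24 : ℝ) / 2 * (∑ k ∈ range L, w (24 + 1 + k) * b₁ (24 + 1 + k) ^ 2 + ∑ k ∈ range L, w (24 + 1 + k) * b₂ (24 + 1 + k) ^ 2)
          + (∑ k ∈ range L, w (24 + 2 + k) * a₁ (24 + 2 + k) ^ 2 + ∑ k ∈ range L, w (24 + 2 + k) * a₂ (24 + 2 + k) ^ 2) / (2 * (delta 24 : ℝ)))) :
    0 ≤ (qform (q1Tab 24 20 (Am Scalars.Gx SpecPieces.M8.piHi 8) (Cm Scalars.Gx Scalars.piLo 8)) (24 + 20 + 4) c₁ + qform (q1Tab 24 20 (Am Scalars.Gx SpecPieces.M8.piHi 8) (Cm Scalars.Gx Scalars.piLo 8)) (24 + 20 + 4) c₂)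
        + (((Am Scalars.Gx SpecPieces.M8.piHi 8) : ℝ) * (∑ k ∈ range L, w (24 + 20 + 4 + k) * c₁ (24 + 20 + 4 + k) ^ 2 + ∑ k ∈ range L, w (24 + 20 + 4 + k) * c₂ (24 + 20 + 4 + k) ^ 2)
           + 8 * (∑ k ∈ range L, w (24 + 2 + k) * a₁ (24 + 2 + k) ^ 2 + ∑ k ∈ range L, w (24 + 2 + k) * a₂ (24 + 2 + k) ^ 2)
           + ((Cm Scalars.Gx Scalars.piLo 8) : ℝ) * (∑ k ∈ range L, w (24 + 1 + k) * b₁ (24 + 1 + k) ^ 2 + ∑ k ∈ range L, w (24 + 1 + k) * b₂ (24 + 1 + k) ^ 2))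
        - ((Dm Scalars.Gx Scalars.piLo 8) : ℝ) * ((∑ p ∈ range (20 + 1), phi p * (bform (eTab 24 20 p) (24 + 20 + 4) c₁ c₂ - bform (eTab 24 20 p) (24 + 20 + 4) c₂ c₁)) + Xt) := by
  have h := mode_ineq hA₁ h0a₁ hB₁ hw₁ hA₂ h0a₂ hB₂ hw₂ L hX
  have hT2 : 0 ≤ (∑ k ∈ range L, w (24 + 20 + 4 + k) * c₁ (24 + 20 + 4 + k) ^ 2 + ∑ k ∈ range L, w (24 + 20 + 4 + k) * c₂ (24 + 20 + 4 + k) ^ 2) :=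
    add_nonneg (Finset.sum_nonneg fun k _ => mul_nonneg (w_pos _).le (sq_nonneg _)) (Finset.sum_nonneg fun k _ => mul_nonneg (w_pos _).le (sq_nonneg _))
  have hs := mul_nonneg slack hT2
  linarith

end Summit.NavierStokesRegularity.TurbBounds.Certs.S1000.ModeForm.M8
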